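import Literature.MathematicalPhysics.QuantumLattice.HubbardScaleReportCT

/-!
# Crux `SeededBrokenRegimeBoseFermiPinned` (stmt-HubbardSuperconductivity-14047), line `seed-strength-flow` — stub `stub_cooperKeptKernelTwo` (N4)

WHAT. The kept Cooper term `𝒦^K(F) = cooperKeptCT L M β μ K Λ₀ F`
(`Literature/MathematicalPhysics/QuantumLattice/HubbardScaleReportCT.lean`) is a `ℂ`-linear combination
of the monomials `ψ⁺_{k₁↑} ψ⁺_{k₂↓} ψ⁻_{k₄↓} ψ⁻_{k₃↑}`, i.e. it is homogeneous of degree `4` in the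
Grassmann generators.  Its `2`-point kernel
`kernel ℂ 𝒦 2 X = (2!)⁻¹ · constPart (∂_{X₁}∂_{X₀} 𝒦)`
(`Literature/MathematicalPhysics/QuantumLattice/GrassmannKernels.lean`) therefore vanishes at EVERY
configuration `X : Fin 2 → HubbardFieldIdx L M`: two derivatives of a product of four generators is a
`ℤ`-combination of products of two generators, and `constPart` kills every product with a leading
generator.  Consequently the quadratic kernel of the remainder `𝒢 − 𝒬(q) − 𝒦(𝒢)` is that of
`𝒢 − 𝒬(q)` alone (the quadratic-mismatch floor N6 of the line).

SOURCE: folklore (degree count in a finite-dimensional Grassmann algebra).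

The file proves, in the sub-namespace `CooperKeptKernelTwo`, the generic facts
`iterDeriv_two_apply` (unfolding two iterated derivatives),
`constPart_grassmannDeriv_gen_mul_gen_mul` (`constPart (∂_V (ψ(b) · (ψ(c) · w))) = 0`) and
`constPart_iterDeriv_two_gen_mul_gen_mul_gen_mul_gen`
(`constPart (iterDeriv X (ψ(a)ψ(b)ψ(c)ψ(d))) = 0` for `X : Fin 2 → Γ`), then the
`constPart ∘ iterDeriv` form `constPart_iterDeriv_two_cooperKeptCT` by linearity (pushed through the
four label sums, the shell `if` and the coefficient `•` of `cooperKeptCT`), and finally the registered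
stub.
-/

set_option linter.dupNamespace false -- Summit.<S>.<S> doubles the summit name (tree convention)

namespace Summit.HubbardSuperconductivity.HubbardSuperconductivity.Theorems.AposterioriCapRgSeededBrokenRegimeBoseFermiPinned

open Literature.MathematicalPhysics.QuantumLattice Literature.Probability.LatticeModels GrassmannAlgebra

namespace CooperKeptKernelTwo

/-! ### Generic: two derivatives of a product of four generators have no constant part -/

section Generic

variable (R : Type*) [CommRing R] {Γ : Type*}

/-- Two iterated derivatives, unfolded: `iterDeriv (X₀,X₁) F = ∂_{X₁} (∂_{X₀} F)`. [folklore] -/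
theorem iterDeriv_two_apply (X : Fin 2 → Γ) (F : GrassmannAlgebra R Γ) :
    iterDeriv R X F = grassmannDeriv R (X 1) (grassmannDeriv R (X 0) F) := by
  simp only [iterDeriv, List.ofFn_succ, Fin.isValue, Fin.succ_zero_eq_one, List.ofFn_zero,
    List.reverse_cons, List.reverse_nil, List.nil_append, List.cons_append, List.prod_cons,
    List.prod_nil, mul_one, Module.End.mul_apply]

/-- One derivative of `ψ(b) · (ψ(c) · w)` has no constant part:
`constPart (∂_V (ψ(b)ψ(c) w)) = δ_{Vb} · constPart (ψ(c) w) - constPart (ψ(b) · …) = 0`, both terms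
carrying a leading generator. [folklore] -/
theorem constPart_grassmannDeriv_gen_mul_gen_mul [DecidableEq Γ] (V b c : Γ) (w : GrassmannAlgebra R Γ) :
    constPart R (grassmannDeriv R V (gen R b * (gen R c * w))) = 0 := by
  rw [grassmannDeriv_gen_mul, map_sub, map_mul, constPart_gen, zero_mul, sub_zero]
  split_ifs
  · rw [map_mul, constPart_gen, zero_mul]
  · rw [map_zero]

/-- A product of four generators has no `2`-point coefficient:
`constPart (∂_{X₁}∂_{X₀} (ψ(a)ψ(b)ψ(c)ψ(d))) = 0` — the first derivative gives
`δ_{X₀a} ψ(b)ψ(c)ψ(d) - ψ(a) ∂_{X₀}(ψ(b)ψ(c)ψ(d))`, and after the second derivative every surviving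
term still carries a leading generator, killed by `constPart`. [folklore] -/
theorem constPart_iterDeriv_two_gen_mul_gen_mul_gen_mul_gen [DecidableEq Γ] (X : Fin 2 → Γ)
    (a b c d : Γ) : constPart R (iterDeriv R X (gen R a * gen R b * gen R c * gen R d)) = 0 := by
  have h : ∀ V, constPart R (grassmannDeriv R V (gen R b * (gen R c * gen R d))) = 0 := fun V =>
    constPart_grassmannDeriv_gen_mul_gen_mul R V b c (gen R d)
  rw [iterDeriv_two_apply, mul_assoc, mul_assoc, grassmannDeriv_gen_mul, map_sub,
    grassmannDeriv_gen_mul R (X 1) a, map_sub, map_sub, map_mul (constPart R), constPart_gen,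
    zero_mul, sub_zero]
  split_ifs <;> simp only [map_zero, h, sub_zero]

end Generic

/-! ### The kept Cooper term has no quadratic coefficient -/

/-- `constPart (iterDeriv X 𝒦^K(F)) = 0` for every `X : Fin 2 → HubbardFieldIdx L M`: the kept Cooper term
`cooperKeptCT L M β μ K Λ₀ F` is a `ℂ`-linear combination of the degree-`4` Cooper monomials
`ψ⁺_{k₁↑} ψ⁺_{k₂↓} ψ⁻_{k₄↓} ψ⁻_{k₃↑}`, each killed by
`constPart_iterDeriv_two_gen_mul_gen_mul_gen_mul_gen` (the `constPart ∘ iterDeriv` shape of `kernel`).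
[folklore] -/
theorem constPart_iterDeriv_two_cooperKeptCT (L M : ℕ) [NeZero L] (β μ : ℝ) (K : TrigPolyC4v) (Λ₀ : ℝ)
    (F : HubbardGrassmann L M) (X : Fin 2 → HubbardFieldIdx L M) :
    constPart ℂ (iterDeriv ℂ X (cooperKeptCT L M β μ K Λ₀ F)) = 0 := by
  rw [cooperKeptCT]
  simp only [map_sum]
  refine Finset.sum_eq_zero fun k₁ _ => Finset.sum_eq_zero fun k₂ _ =>
    Finset.sum_eq_zero fun k₃ _ => Finset.sum_eq_zero fun k₄ _ => ?_
  split_ifs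
  · simp only [map_smul, psiPlus, psiMinus, constPart_iterDeriv_two_gen_mul_gen_mul_gen_mul_gen,
      smul_zero]
  · rw [map_zero, map_zero]

end CooperKeptKernelTwo

/-! ### N4 -/

/-- **N4 (`CooperKeptKernelTwo`)**: the kept Cooper term `𝒦^K(F) = cooperKeptCT L M β μ K Λ₀ F`
(homogeneous of degree `4`: monomials `ψ⁺↑ψ⁺↓ψ⁻↓ψ⁻↑`) has vanishing `2`-point kernel at every
configuration `X : Fin 2 → HubbardFieldIdx L M`. [folklore] -/
theorem stub_cooperKeptKernelTwo :
    ∀ (L M : ℕ) [NeZero L] (β μ : ℝ) (K : TrigPolyC4v) (Λ₀ : ℝ) (F : HubbardGrassmann L M)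
      (X : Fin 2 → HubbardFieldIdx L M), kernel ℂ (cooperKeptCT L M β μ K Λ₀ F) 2 X = 0 := by
  intro L M _ β μ K Λ₀ F X
  rw [kernel_def, CooperKeptKernelTwo.constPart_iterDeriv_two_cooperKeptCT, mul_zero]

end Summit.HubbardSuperconductivity.HubbardSuperconductivity.Theorems.AposterioriCapRgSeededBrokenRegimeBoseFermiPinned
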